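import Summits.RiemannHypothesis.RiemannHypothesis.Theorems.WeilTwoPrimeDeflE25EDef
import Summits.RiemannHypothesis.RiemannHypothesis.Theorems.WeilTwoPrimeDeflE25OKappa
import Summits.RiemannHypothesis.RiemannHypothesis.Theorems.WeilTwoPrimeDeflE25OCert2
import HarnessLib

/-!
# Even-sector deflated two-prime certificate E25E: `κ`, `β₂₃ ≤ κ`, `κ − β₂₃ = κ'`, the scalar side conditions and the moment check — by transfer from certificate E25O

`WeilCert23.kappaQ`, `checkScalars` and `checkNu` read only `(a₀, N, T, wL, pg, pnu, j, b, cells, nuData)`, which `weilCertDeflE25E` shares with `weilCertDeflE25O` (same literals, same table by name), so the landed kernel facts of certificate E25O transfer by definitional unfolding (no kernel evaluation here). Pure proof file.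
-/

set_option linter.dupNamespace false

noncomputable section

namespace Summit.RiemannHypothesis.RiemannHypothesis.Theorems.EvenWinsBeyondArch

open Literature.NumberTheory.LFunctions

/-- **The value of `κ`** of certificate E25E (= that of certificate E25O, definitionally). [folklore] -/
theorem kappaQ_weilCertDeflE25E : weilCertDeflE25E.kappaQ = weilCertDeflE25OKappaLit :=
  kappaQ_weilCertDeflE25O

/-- `β₂₃ ≤ κ` for certificate E25E. [folklore] -/
theorem beta_le_kappaQ_weilCertDeflE25E : weilCertDeflE25EBeta ≤ weilCertDeflE25E.kappaQ := by
  rw [kappaQ_weilCertDeflE25E]; unfold weilCertDeflE25EBeta weilCertDeflE25OKappaLit; norm_num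

/-- `κ − β₂₃ = κ'` for certificate E25E. [folklore] -/
theorem kappaQ_sub_beta_weilCertDeflE25E : weilCertDeflE25E.kappaQ - weilCertDeflE25EBeta = weilCertDeflE25EKappa' := by
  rw [kappaQ_weilCertDeflE25E]; unfold weilCertDeflE25EBeta weilCertDeflE25OKappaLit weilCertDeflE25EKappa'; norm_num

/-- **The scalar side conditions** of certificate E25E (transferred from certificate E25O). [folklore] -/
theorem checkScalars_weilCertDeflE25E : weilCertDeflE25E.checkScalars = true :=
  checkScalars_weilCertDeflE25O

/-- **The moment table of certificate E25E is correct** (it is the checked table of certificate E25O). [folklore] -/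
theorem checkNu_weilCertDeflE25E : weilCertDeflE25E.checkNu = true :=
  checkNu_weilCertDeflE25O

end Summit.RiemannHypothesis.RiemannHypothesis.Theorems.EvenWinsBeyondArch
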